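import Literature.MathematicalPhysics.QuantumFieldTheory.Balaban1983to89.B7TranslationCovariance
import Literature.MathematicalPhysics.QuantumFieldTheory.Balaban1983to89.B12Ineq418Flat

/-!
# `Balaban1983to89.B12Ineq417General` — [Balaban1987RG1] (4.17) p. 285 at a GENERAL background from three displayed inputs
(local chart + analyticity + size of `Q_j(U₀, ·)`, and a bound on the background variation) by the CAUCHY ESTIMATE — no
Proposition 5 of [7] needed —, with the inputs DISCHARGED at `U₀ = 1` (a second, Prop-5-free proof of (4.17) at the flat background)

HONEST FRAMING (cell `lit-balaban`, verbatim): statement-level skeleton of published theorems with citation tags; proofs where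
landed; nothing here is a claim about the Yang–Mills mass gap.

CITATION HEADER.  T. Bałaban, *Renormalization group approach to lattice gauge field theories. I*, Commun. Math. Phys. **109** (1987)
249–301 [Balaban1987RG1] (cell paper B12; journal page = PDF page + 248), (4.16)–(4.17) p. 285: «(3.32) and Proposition 5 [7] on
functional derivatives of averaging operations imply |(∂_νB_μ)(x)| < O(1)(α₂ + B₃O(1)Mα₀)(L^jη)²»; T. Bałaban, *Averaging operations
for lattice gauge theories*, Commun. Math. Phys. **98** (1985) 17–51 [Balaban1985Averaging] (cell paper B7), Proposition 4 p. 38 with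
(131) («|Q_j(U₀, ηA)| < 2L^jηα₁») and its analyticity clause («Q(V₀, A, c) is an analytic function of A», p. 36), (127) p. 37.
Unit `lit-balaban-r20` gen 4 (fold owner of B12), second instalment of the NE9 owner's NEED-3 (a) (HOME/INBOX 2026-08-21T03:5xZ):
SUPPLEMENT to row B12.Eq4.16-4.18 (owner cell r09 `typed p243650`; flat supplements `B12Ineq417Flat` p246801, `B12Ineq418Flat`
p247232; covariance `B7TranslationCovariance` p247411).

THE POINT.  By `B7TranslationCovariance.eq416_general_split`, `(∂_νB_μ)(x)` at a general background `U₀` is the sum of the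
`ζ̃`-difference term, the FIELD-variation term `ζ̃(x)[Q_{j,μ}(tU₀, tB)(x) − Q_{j,μ}(tU₀, B)(x)]` (`t = t_{L^je_ν}`) and the
BACKGROUND-variation term `ζ̃(x)[Q_{j,μ}(tU₀, B)(x) − Q_{j,μ}(U₀, B)(x)]`.  The field-variation term needs NO functional-derivative
proposition: if `Q_{j,μ}(tU₀, ·)(x)` factors through the restriction to a finite bond set `S` by a map `φ` holomorphic on the sup-norm
polydisc of radius `b₁` and bounded there by `M` (Proposition 4 of [7] at the background `tU₀`: analyticity + (131)), then the
one-variable Cauchy estimate along the segment from `B|_S` to `(tB)|_S` (`norm_sub_le_of_chart`, from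
`B12Ineq418Flat.norm_sub_le_of_ball`) bounds it by `M·‖(tB − B)|_S‖/ρ ≤ M·L^jg/ρ`, `ρ` the margin `b + L^jg + ρ ≤ b₁`, `g` the size of
the fine `ν`-differences of `B` (`B12Ineq417Flat.norm_shiftCfg_sub_le`).  Hence (`ineq417_general`)
`‖(∂_νB_μ)(x)‖ ≤ δ·M₀ + |ζ̃(x)|·(M·L^jg/ρ + ε_bg)` with `M₀` the size of `Q_j(U₀, B)` and `ε_bg` the bound on the background variation
— at a general `U₀` these four inputs are HYPOTHESES here (the tree's general-background Proposition 4, `B7Prop4GeneralLevels.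
prop4_general_of_prop3` / `B7Prop4GeneralInduction.prop4_induction_analyticAt`, carries one-step inputs discharged by its consumers;
the background variation is a Proposition 6-type statement of [7]); at `U₀ = 1` ALL of them are discharged in §3 from b07's flat
Proposition 4 (`B7Prop5FlatOperator.analyticAt_avgMap_apply`, `B12Ineq417Flat.norm_logIter_le`, `logIter_eq_avgMap_restr`), giving
`ineq417_flat_cauchy`: `‖(∂_νB_μ)(x)‖ ≤ δ·2L^jb + |ζ̃(x)|·2L^jb₁·L^jg/ρ` whenever `C₃L^jb₁ ≤ 1`, `b + L^jg + ρ ≤ b₁` — the printed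
`O(1)(…)(L^jη)²` law with the DICTIONARY of `B12Ineq417Flat` (`b, b₁ = O(η)`, `g = O(η²)`, `δ = O(L^jη)`, `ρ = b₁/4`).

WHAT THIS FILE PROVES (kernel, 0 sorry, standard axioms; no definitions, no `def … : Prop`): `norm_sub_le_of_chart` (pure complex
analysis), `norm_restr_le`, `norm_restr_shift_sub_le` (sizes of restricted fields), **`ineq417_general`**, **`ineq417_flat_cauchy`**.

DIVERGENCES / NOT PROVED.  `ℤ^d`, no torus; constants OURS; at a general background the chart/analyticity/size/background-variation
inputs are hypotheses displayed in the theorem, not discharged; «hold for δB also» and (4.18) at a general background are not treated.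
-/

noncomputable section

open scoped BigOperators
open Set Metric
open Literature.MathematicalPhysics.QuantumFieldTheory.Balaban1983to89
open Literature.MathematicalPhysics.QuantumFieldTheory.Balaban1983to89.B7Prop1Explicit (e)
open Literature.MathematicalPhysics.QuantumFieldTheory.Balaban1983to89.B7Prop3Flat (insCfg)
open Literature.MathematicalPhysics.QuantumFieldTheory.Balaban1983to89.B7Prop4Flat (logIter)
open Literature.MathematicalPhysics.QuantumFieldTheory.Balaban1983to89.B7Prop5Flat (C3 C3_pos restr)
open Literature.MathematicalPhysics.QuantumFieldTheory.Balaban1983to89.B7Prop5FlatOperator (avgMap avgMap_apply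
  analyticAt_avgMap_apply)
open Literature.MathematicalPhysics.QuantumFieldTheory.Balaban1983to89.B7Prop4GeneralLevels (logCovIter logCovIter_one_left)
open Literature.MathematicalPhysics.QuantumFieldTheory.Balaban1983to89.B12Ineq417Flat (shiftCfg shiftCfg_apply norm_shiftCfg_sub_le
  locB dlocB boxBonds oneBond theBond logIter_eq_avgMap_restr norm_logIter_le)
open Literature.MathematicalPhysics.QuantumFieldTheory.Balaban1983to89.B12Ineq418Flat (norm_sub_le_of_ball)
open Literature.MathematicalPhysics.QuantumFieldTheory.Balaban1983to89.B7TranslationCovariance (shiftCfg_one locBG dlocBG dlocBG_one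
  eq416_general_split)

namespace Literature.MathematicalPhysics.QuantumFieldTheory.Balaban1983to89.B12Ineq417General

variable {d : ℕ}

/-! ## §1 The Cauchy estimate for a first-order variation through a chart -/

section Cauchy

variable {P F : Type*} [NormedAddCommGroup P] [NormedSpace ℂ P] [NormedAddCommGroup F] [NormedSpace ℂ F] [CompleteSpace F]

/-- **First-order variation of a bounded holomorphic map by the Cauchy estimate**: if `φ` is holomorphic on the ball `‖q‖ < b₁` and
bounded there by `M`, then for `‖p‖ + ‖w‖ + ρ ≤ b₁`, `ρ > 0`, `‖φ(p + w) − φ(p)‖ ≤ M‖w‖/ρ` (the one-variable estimate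
`B12Ineq418Flat.norm_sub_le_of_ball` on `s ↦ φ(p + sw)`, holomorphic and bounded on `|s| < 1 + ρ/‖w‖`).  For the sup-norm polydisc of
bond variables this IS an operator-type bound `O(M/ρ)` for the variation of an averaging functional — the use the print makes of
«Proposition 5 [7]». [cite: Balaban1987RG1, (4.17) p.285; Balaban1985Averaging, Prop. 4 p.38] (standard complex analysis; our proof) -/
theorem norm_sub_le_of_chart {φ : P → F} {b₁ M ρ : ℝ} (hφ : DifferentiableOn ℂ φ (ball 0 b₁))
    (hM : ∀ q ∈ ball (0 : P) b₁, ‖φ q‖ ≤ M) (hρ : 0 < ρ) (p w : P) (hpw : ‖p‖ + ‖w‖ + ρ ≤ b₁) :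
    ‖φ (p + w) - φ p‖ ≤ M * ‖w‖ / ρ := by
  by_cases hw : w = 0
  · subst hw
    simp only [add_zero, sub_self, norm_zero, mul_zero, zero_div, le_refl]
  have hwpos : 0 < ‖w‖ := norm_pos_iff.2 hw
  set R : ℝ := 1 + ρ / ‖w‖ with hR
  have hR1 : 1 < R := by rw [hR]; linarith [div_pos hρ hwpos]
  -- the segment's complex neighbourhood maps into the ball
  have hmaps : ∀ s ∈ ball (0 : ℂ) R, p + s • w ∈ ball (0 : P) b₁ := by
    intro s hs
    rw [mem_ball_zero_iff] at hs ⊢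
    have h1 : ‖s‖ * ‖w‖ < ‖w‖ + ρ := by
      have := mul_lt_mul_of_pos_right hs hwpos
      rwa [hR, add_mul, one_mul, div_mul_cancel₀ _ hwpos.ne'] at this
    calc ‖p + s • w‖ ≤ ‖p‖ + ‖s • w‖ := norm_add_le _ _
      _ = ‖p‖ + ‖s‖ * ‖w‖ := by rw [norm_smul]
      _ < ‖p‖ + (‖w‖ + ρ) := by linarith
      _ ≤ b₁ := by linarith
  have hg : DifferentiableOn ℂ (fun s : ℂ => φ (p + s • w)) (ball 0 R) := by
    refine hφ.comp ?_ fun s hs => hmaps s hs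
    exact ((differentiableOn_const p).add ((differentiableOn_id).smul_const w))
  have hgM : ∀ s ∈ ball (0 : ℂ) R, ‖φ (p + s • w)‖ ≤ M := fun s hs => hM _ (hmaps s hs)
  have h := norm_sub_le_of_ball hR1 hg hgM
  simp only [one_smul, zero_smul, add_zero] at h
  have hRm : R - 1 = ρ / ‖w‖ := by rw [hR]; ring
  rw [hRm, div_div_eq_mul_div] at h
  exact h

end Cauchy

/-! ## §2 (4.17) at a general background from displayed inputs -/

section General

variable {𝔸 : Type*} [NormedRing 𝔸] [NormedAlgebra ℂ 𝔸] [CompleteSpace 𝔸]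

omit [NormedAlgebra ℂ 𝔸] [CompleteSpace 𝔸] in
/-- The sup norm of a restricted field is bounded by the sup of the field. [cite: Balaban1987RG1, (3.32) p.277] (elementary API; our proof) -/
theorem norm_restr_le (S : Finset (B7Prop1Explicit.Site d × Fin d)) (F : B7Prop1Explicit.Site d → Fin d → 𝔸) {b : ℝ}
    (hb : 0 ≤ b) (hF : ∀ x κ, ‖F x κ‖ ≤ b) : ‖restr S F‖ ≤ b :=
  (pi_norm_le_iff_of_nonneg hb).2 fun _ => hF _ _

omit [NormedAlgebra ℂ 𝔸] [CompleteSpace 𝔸] in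
/-- **The translation step costs `L^j` fine differences**: `‖(t_{L^je_ν}B − B)|_S‖ ≤ L^j·g` when the fine `ν`-differences of `B`
are `≤ g` (print: «the derivative ∂^ξA_λ can be bounded by O(1)L^jη»). [cite: Balaban1987RG1, (4.16)–(4.17) p.285] -/
theorem norm_restr_shift_sub_le (S : Finset (B7Prop1Explicit.Site d × Fin d)) (B : B7Prop1Explicit.Site d → Fin d → 𝔸)
    (L j : ℕ) (ν : Fin d) {g : ℝ} (hg0 : 0 ≤ g) (hg : ∀ x κ, ‖B (x + e ν) κ - B x κ‖ ≤ g) :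
    ‖restr S (shiftCfg (((L : ℤ) ^ j) • e ν) B) - restr S B‖ ≤ (L : ℝ) ^ j * g := by
  refine (pi_norm_le_iff_of_nonneg (by positivity)).2 fun s => ?_
  have h := norm_shiftCfg_sub_le ν (fun y => B y s.1.2) (fun y => hg y s.1.2) (L ^ j) s.1.1
  have hcast : (((L ^ j : ℕ) : ℤ)) • e ν = ((L : ℤ) ^ j) • e ν := by push_cast; rfl
  rw [hcast] at h
  simpa [restr, shiftCfg] using h

/-- **(4.17) AT A GENERAL BACKGROUND FROM DISPLAYED INPUTS.**  Let `t = t_{L^je_ν}`.  INPUTS: (chart) `Q_{j,μ}(tU₀, F)(x) = φ(F|_S)`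
for a finite bond set `S` and all `F`; (analyticity) `φ` holomorphic on the sup-norm ball of radius `b₁`; (size) `‖φ‖ ≤ M` there
and `‖Q_{j,μ}(U₀, B)(x + e_ν)‖ ≤ M₀`; (background variation) `‖Q_{j,μ}(tU₀, B)(x) − Q_{j,μ}(U₀, B)(x)‖ ≤ ε_bg`; and on the data:
`sup ‖B‖ ≤ b`, fine `ν`-differences `≤ g`, `|ζ̃(x+e_ν) − ζ̃(x)| ≤ δ`, a margin `b + L^jg + ρ ≤ b₁`.  CONCLUSION:
`‖(∂_νB_μ)(x)‖ ≤ δ·M₀ + |ζ̃(x)|·(M·L^jg/ρ + ε_bg)`.  (At a translation-invariant `U₀`, `ε_bg = 0`; at `U₀ = 1` every input is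
discharged: `ineq417_flat_cauchy`.) [cite: Balaban1987RG1, (4.17) p.285; Balaban1985Averaging, Prop. 4 p.38, (131) p.38] -/
theorem ineq417_general (ζ : B7Prop1Explicit.Site d → ℝ) (L : ℕ) (U₀ : B7Prop1Explicit.Site d → Fin d → 𝔸ˣ)
    (B : B7Prop1Explicit.Site d → Fin d → 𝔸) (j : ℕ) (ν : Fin d) (z : B7Prop1Explicit.Site d) (μ : Fin d)
    {S : Finset (B7Prop1Explicit.Site d × Fin d)} (φ : (S → 𝔸) → 𝔸) {b b₁ M M₀ g ρ εbg δ : ℝ}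
    (hchart : ∀ F : B7Prop1Explicit.Site d → Fin d → 𝔸,
      logCovIter L (shiftCfg (((L : ℤ) ^ j) • e ν) U₀) F j z μ = φ (restr S F))
    (hφ : DifferentiableOn ℂ φ (ball 0 b₁)) (hM0 : 0 ≤ M) (hM : ∀ q ∈ ball (0 : S → 𝔸) b₁, ‖φ q‖ ≤ M)
    (hb : 0 ≤ b) (hB : ∀ x κ, ‖B x κ‖ ≤ b) (hg0 : 0 ≤ g) (hg : ∀ x κ, ‖B (x + e ν) κ - B x κ‖ ≤ g)
    (hρ : 0 < ρ) (hroom : b + (L : ℝ) ^ j * g + ρ ≤ b₁)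
    (hQ : ‖logCovIter L U₀ B j (z + e ν) μ‖ ≤ M₀)
    (hbg : ‖logCovIter L (shiftCfg (((L : ℤ) ^ j) • e ν) U₀) B j z μ - logCovIter L U₀ B j z μ‖ ≤ εbg)
    (hζ : |ζ (z + e ν) - ζ z| ≤ δ) :
    ‖dlocBG ζ L U₀ B j ν z μ‖ ≤ δ * M₀ + |ζ z| * (M * ((L : ℝ) ^ j * g) / ρ + εbg) := by
  have hδ0 : 0 ≤ δ := le_trans (abs_nonneg _) hζ
  -- the field-variation term through the chart
  set p : S → 𝔸 := restr S B with hp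
  set w : S → 𝔸 := restr S (shiftCfg (((L : ℤ) ^ j) • e ν) B) - restr S B with hw
  have hpw_eq : restr S (shiftCfg (((L : ℤ) ^ j) • e ν) B) = p + w := by rw [hp, hw]; abel
  have hpn : ‖p‖ ≤ b := norm_restr_le S B hb hB
  have hwn : ‖w‖ ≤ (L : ℝ) ^ j * g := norm_restr_shift_sub_le S B L j ν hg0 hg
  have hpw : ‖p‖ + ‖w‖ + ρ ≤ b₁ := by linarith
  have hfield : ‖logCovIter L (shiftCfg (((L : ℤ) ^ j) • e ν) U₀) (shiftCfg (((L : ℤ) ^ j) • e ν) B) j z μ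
      - logCovIter L (shiftCfg (((L : ℤ) ^ j) • e ν) U₀) B j z μ‖ ≤ M * ((L : ℝ) ^ j * g) / ρ := by
    rw [hchart, hchart, hpw_eq, ← hp]
    calc ‖φ (p + w) - φ p‖ ≤ M * ‖w‖ / ρ := norm_sub_le_of_chart hφ hM hρ p w hpw
      _ ≤ M * ((L : ℝ) ^ j * g) / ρ :=
        div_le_div_of_nonneg_right (mul_le_mul_of_nonneg_left hwn hM0) hρ.le
  rw [eq416_general_split]
  calc ‖(ζ (z + e ν) - ζ z) • logCovIter L U₀ B j (z + e ν) μ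
        + ζ z • (logCovIter L (shiftCfg (((L : ℤ) ^ j) • e ν) U₀) (shiftCfg (((L : ℤ) ^ j) • e ν) B) j z μ
            - logCovIter L (shiftCfg (((L : ℤ) ^ j) • e ν) U₀) B j z μ)
        + ζ z • (logCovIter L (shiftCfg (((L : ℤ) ^ j) • e ν) U₀) B j z μ - logCovIter L U₀ B j z μ)‖
      ≤ ‖(ζ (z + e ν) - ζ z) • logCovIter L U₀ B j (z + e ν) μ‖
        + ‖ζ z • (logCovIter L (shiftCfg (((L : ℤ) ^ j) • e ν) U₀) (shiftCfg (((L : ℤ) ^ j) • e ν) B) j z μ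
            - logCovIter L (shiftCfg (((L : ℤ) ^ j) • e ν) U₀) B j z μ)‖
        + ‖ζ z • (logCovIter L (shiftCfg (((L : ℤ) ^ j) • e ν) U₀) B j z μ - logCovIter L U₀ B j z μ)‖ :=
        norm_add₃_le
    _ ≤ δ * M₀ + |ζ z| * (M * ((L : ℝ) ^ j * g) / ρ) + |ζ z| * εbg := by
        refine add_le_add (add_le_add ?_ ?_) ?_
        · rw [norm_smul, Real.norm_eq_abs]
          exact mul_le_mul hζ hQ (norm_nonneg _) hδ0
        · rw [norm_smul, Real.norm_eq_abs]
          exact mul_le_mul_of_nonneg_left hfield (abs_nonneg _)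
        · rw [norm_smul, Real.norm_eq_abs]
          exact mul_le_mul_of_nonneg_left hbg (abs_nonneg _)
    _ = δ * M₀ + |ζ z| * (M * ((L : ℝ) ^ j * g) / ρ + εbg) := by ring

end General

/-! ## §3 The inputs discharged at the flat background: (4.17) at `U₀ = 1` by the Cauchy route -/

section Flat

variable {𝔸 : Type*} [NormedRing 𝔸] [NormedAlgebra ℂ 𝔸] [CompleteSpace 𝔸]

/-- **(4.17) AT `U₀ = 1`, PROPOSITION-5-FREE**: for `L ≥ 2`, `C₃(d, L)·L^j·b₁ ≤ 1`, `sup ‖B‖ ≤ b`, fine `ν`-differences `≤ g`,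
a margin `b + L^jg + ρ ≤ b₁`, `|ζ̃(x+e_ν) − ζ̃(x)| ≤ δ`: `‖(∂_νB_μ)(x)‖ ≤ δ·2L^jb + |ζ̃(x)|·2L^jb₁·L^jg/ρ` — `ineq417_general`
with the chart `B12Ineq417Flat.logIter_eq_avgMap_restr`, the analyticity `B7Prop5FlatOperator.analyticAt_avgMap_apply` and the size
(131) `B12Ineq417Flat.norm_logIter_le` of b07's flat Proposition 4, and `ε_bg = 0` (`t1 = 1`).  (Compare `B12Ineq417Flat.ineq417_flat`,
whose second constant is `2dL^j(1 + C₃L^jb)` from Proposition 5's operator form.) [cite: Balaban1987RG1, (4.17) p.285;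
Balaban1985Averaging, Prop. 4 p.38, (131) p.38] -/
theorem ineq417_flat_cauchy (ζ : B7Prop1Explicit.Site d → ℝ) (L : ℕ) (hL : 2 ≤ L) (B : B7Prop1Explicit.Site d → Fin d → 𝔸)
    (j : ℕ) (ν : Fin d) (z : B7Prop1Explicit.Site d) (μ : Fin d) {b b₁ g ρ δ : ℝ} (hb : 0 ≤ b)
    (hk : C3 d L * ((L : ℝ) ^ j * b₁) ≤ 1) (hB : ∀ x κ, ‖B x κ‖ ≤ b) (hg0 : 0 ≤ g)
    (hg : ∀ x κ, ‖B (x + e ν) κ - B x κ‖ ≤ g) (hρ : 0 < ρ) (hroom : b + (L : ℝ) ^ j * g + ρ ≤ b₁)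
    (hζ : |ζ (z + e ν) - ζ z| ≤ δ) :
    ‖dlocB ζ L B j ν z μ‖
      ≤ δ * (2 * ((L : ℝ) ^ j * b)) + |ζ z| * (2 * ((L : ℝ) ^ j * b₁) * ((L : ℝ) ^ j * g) / ρ + 0) := by
  have hL1 : 1 ≤ L := le_trans (by norm_num) hL
  have hC3 : 0 < C3 d L := C3_pos d L hL1
  have hb₁ : b ≤ b₁ := by nlinarith [pow_nonneg (Nat.cast_nonneg L : (0 : ℝ) ≤ L) j]
  have hb₁0 : 0 ≤ b₁ := le_trans hb hb₁
  have hkb : C3 d L * ((L : ℝ) ^ j * b) ≤ 1 :=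
    le_trans (mul_le_mul_of_nonneg_left (mul_le_mul_of_nonneg_left hb₁ (by positivity)) hC3.le) hk
  set S := boxBonds L j z μ with hS
  set T := oneBond (d := d) z μ with hT
  -- the chart at the (flat = translated flat) background
  have hchart : ∀ F : B7Prop1Explicit.Site d → Fin d → 𝔸,
      logCovIter L (shiftCfg (((L : ℤ) ^ j) • e ν) (1 : B7Prop1Explicit.Site d → Fin d → 𝔸ˣ)) F j z μ
        = (fun q : S → 𝔸 => avgMap L S T j q (theBond z μ)) (restr S F) := by
    intro F
    rw [shiftCfg_one, logCovIter_one_left]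
    exact logIter_eq_avgMap_restr L hL1 F j z μ
  -- analyticity on the open polydisc of radius b₁
  have hφ : DifferentiableOn ℂ (fun q : S → 𝔸 => avgMap L S T j q (theBond z μ)) (ball 0 b₁) := by
    intro q hq
    have hq' : ∀ s, ‖q s‖ ≤ b₁ := fun s => (le_trans (norm_le_pi_norm q s) (mem_ball_zero_iff.1 hq).le)
    exact (analyticAt_avgMap_apply L hL S T j hb₁0 hk hq' (theBond z μ)).differentiableAt.differentiableWithinAt
  -- the size (131) on the polydisc
  have hM : ∀ q ∈ ball (0 : S → 𝔸) b₁, ‖(fun q : S → 𝔸 => avgMap L S T j q (theBond z μ)) q‖ ≤ 2 * ((L : ℝ) ^ j * b₁) := by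
    intro q hq
    have hq' : ∀ s, ‖q s‖ ≤ b₁ := fun s => (le_trans (norm_le_pi_norm q s) (mem_ball_zero_iff.1 hq).le)
    simp only [avgMap_apply]
    exact norm_logIter_le L hL (insCfg S q) j hb₁0 hk (B7Prop5FlatOperator.norm_insCfg_le_of_le hb₁0 hq') _ _
  have hQ : ‖logCovIter L (1 : B7Prop1Explicit.Site d → Fin d → 𝔸ˣ) B j (z + e ν) μ‖ ≤ 2 * ((L : ℝ) ^ j * b) := by
    rw [logCovIter_one_left]
    exact norm_logIter_le L hL B j hb hkb hB _ _
  have hbg : ‖logCovIter L (shiftCfg (((L : ℤ) ^ j) • e ν) (1 : B7Prop1Explicit.Site d → Fin d → 𝔸ˣ)) B j z μ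
      - logCovIter L (1 : B7Prop1Explicit.Site d → Fin d → 𝔸ˣ) B j z μ‖ ≤ 0 := by
    rw [shiftCfg_one, sub_self, norm_zero]
  have h := ineq417_general ζ L (1 : B7Prop1Explicit.Site d → Fin d → 𝔸ˣ) B j ν z μ
    (fun q : S → 𝔸 => avgMap L S T j q (theBond z μ)) hchart hφ (by positivity) hM hb hB hg0 hg hρ hroom hQ hbg hζ
  rwa [dlocBG_one] at h

end Flat

end Literature.MathematicalPhysics.QuantumFieldTheory.Balaban1983to89.B12Ineq417General

end
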